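import Literature.NumberTheory.Rogawski1990.AdelicStableClassSupportFiniteH
import Literature.NumberTheory.Rogawski1990.AdelicStableClassSupportFiniteSemisimple
import Literature.NumberTheory.Rogawski1990.StableClassRegular
import HarnessLib

/-!
# Only finitely many stable classes of `H = U(2) × U(1)` WITH SEMISIMPLE IMAGE carry an adelic matching class through a compact set
(Rogawski (1990), §3.1 p. 19, §5.4 pp. 72–73, §14.5 Thm. 14.5.1 (a) p. 238; Jacobson IV §7 Thm. 5)

Topic `NumberTheory/Rogawski1990`; namespace `Literature.NumberTheory.Rogawski1990`.  THEOREMS ONLY (no definition, no instance, no named fact, no `sorry`).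
The SINGULAR ∕ CENTRAL twin of ★ (SF-st)-H `AdelicStableClassSupportFiniteH`: there the `H`-stable classes are guarded by `G`-regularity (`IsGRegular`, making the
`U(Φ₂)`-component regular semisimple, so that «same characteristic polynomial ⇒ conjugate»); here the guard is only that the `U(Φ₂)`-component be SEMISIMPLE
(★ `IsSemisimpleElt`; the `U(Φ₁)`-component is a scalar), using «semisimple with the same characteristic polynomial ⇒ conjugate» (★
`isStablyConj_of_charpoly_eq_of_isSemisimpleElt` of ★ (SF-st)-s `AdelicStableClassSupportFiniteSemisimple`).  Since `U(Φ₂)` is quasi-split, not every element is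
semisimple, so — unlike the anisotropic `G` of ★ (SF-st)-s — the guard cannot be dropped; it is carried by every class of the finite sets.  The adelic half
(★ (SF-st)-H §2: the three rational scalars `((p_{γ₂})₀, (p_{γ₂})₁, (γ₁)₀₀)` of a class are read off any adèle of its adelic stable class; compactness ⇒ finitely
many scalars) is REUSED by name.

* §1 **`isStablyConjH_of_charpoly_fst_eq_of_snd_eq_of_isSemisimpleElt`**, **`stableClassH_eq_of_coeff_charpoly_fst_eq_of_sndVal_eq_of_isSemisimpleElt`** — a stable
  class of `H(F)` with semisimple `U(J₂)`-component is determined, among such classes, by its three scalars; `IsGRegular.isSemisimpleElt_fst` (rider).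
* §2 **`finite_setOf_stableClassH_meets_of_isSemisimpleElt`** — only finitely many stable classes with semisimple image have an adelic stable class meeting a
  compact `C ⊂ H(𝐀)`; **`finite_setOf_stableClassH_adelicStableOrbitalIntegralH_ne_zero_of_isSemisimpleElt`** (+ `_cc`) — the support of
  `𝒪′_st ↦ Φ^st_H(γ_H(𝒪′_st), f^H)` on the classes with semisimple image is finite, for every class-indexed family of orbital measures and every compactly
  supported `f^H` (the anchored `pinSJHFinite` at ALL classes of the T1 line: every `H`-class there has semisimple image).

## References
* [Rogawski1990] J. D. Rogawski, *Automorphic Representations of Unitary Groups in Three Variables*, Ann. of Math. Stud. 123 (1990), §3.1 p. 19, §5.4 pp. 72–73,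
  §14.5 Thm. 14.5.1 (a) p. 238.
* [Jacobson] N. Jacobson, *Lectures in Abstract Algebra II: Linear Algebra* (1953), Ch. IV §7 Thm. 5.
* [CasselsFrohlichANT1967] J. W. S. Cassels, A. Fröhlich (eds.), *Algebraic Number Theory* (1967), Ch. II §14 (discreteness of `L ⊂ 𝔸_L`).
-/

set_option autoImplicit false

noncomputable section

open NumberField IsDedekindDomain Filter Topology Polynomial MeasureTheory Function
open scoped MatrixGroups

namespace Literature.NumberTheory.Rogawski1990

open Literature.NumberTheory.Automorphic Literature.MeasureTheory.Group
open Literature.AlgebraicGeometry.ShimuraVarieties (unitaryGroup)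
open Literature.LinearAlgebra.Matrix (continuous_charpoly_coeff)

/-! ## §1 Stable classes of `H(F) = U(J₂) × U(J₁)` with semisimple `U(J₂)`-component are determined by three scalars -/

section Algebra

variable {K : Type*} [Field K] {σ : K →+* K} {J₂ : Matrix (Fin 2) (Fin 2) K} {J₁ : Matrix (Fin 1) (Fin 1) K}

/-- **Semisimple with the same characteristic polynomial ⇒ stably conjugate** on `H(F) = U(J₂) × U(J₁)`: if `γ₂`, `γ₂′` are semisimple, `p_{γ₂′} = p_{γ₂}` and
`γ₁′ = γ₁`, then `(γ₂, γ₁) ∼_st (γ₂′, γ₁′)` (★ `isStablyConj_of_charpoly_eq_of_isSemisimpleElt` on the first factor). [cite: Rogawski1990, §3.1 p. 19]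
[cite: Jacobson, Ch. IV §7 Thm. 5] -/
theorem isStablyConjH_of_charpoly_fst_eq_of_snd_eq_of_isSemisimpleElt {a a' : unitaryGroup σ J₂ × unitaryGroup σ J₁} (ha : IsSemisimpleElt σ J₂ a.1)
    (ha' : IsSemisimpleElt σ J₂ a'.1)
    (h₁ : ((a'.1 : GL (Fin 2) K) : Matrix (Fin 2) (Fin 2) K).charpoly = ((a.1 : GL (Fin 2) K) : Matrix (Fin 2) (Fin 2) K).charpoly)
    (h₂ : a'.2 = a.2) : IsStablyConjH σ J₂ J₁ a a' :=
  ⟨isStablyConj_of_charpoly_eq_of_isSemisimpleElt ha ha' h₁.symm, h₂ ▸ IsStablyConj.refl _⟩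

/-- `G`-regular ⇒ the `U(J₂)`-component is semisimple (regular semisimple elements are semisimple, ★ `isSemisimpleElt_of_isRegularElt`): the guard of ★
(SF-st)-H implies the guard of this file. [cite: Rogawski1990, §3.1 p. 19] -/
theorem IsGRegular.isSemisimpleElt_fst {J₃ : Matrix (Fin 3) (Fin 3) K} {h : endoForm J₂ J₁ = J₃} {a : unitaryGroup σ J₂ × unitaryGroup σ J₁}
    (ha : IsGRegular σ J₂ J₁ J₃ h a) : IsSemisimpleElt σ J₂ a.1 :=
  isSemisimpleElt_of_isRegularElt ha.isRegularElt_fst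

/-- A `1 × 1` invertible matrix is its entry. [folklore] -/
private theorem GL_fin_one_eq_of_apply_eq' {x y : GL (Fin 1) K} (h : (x : Matrix (Fin 1) (Fin 1) K) 0 0 = (y : Matrix (Fin 1) (Fin 1) K) 0 0) : x = y := by
  refine Units.ext (Matrix.ext fun i j => ?_)
  fin_cases i; fin_cases j
  exact h

/-- The characteristic polynomial of a `2 × 2` matrix over a field is determined by its coefficients in degrees `0` and `1` (it is monic of degree `2`).
[folklore] -/
private theorem charpoly_eq_of_coeff_zero_eq_of_coeff_one_eq' {A B : Matrix (Fin 2) (Fin 2) K} (h0 : A.charpoly.coeff 0 = B.charpoly.coeff 0)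
    (h1 : A.charpoly.coeff 1 = B.charpoly.coeff 1) : A.charpoly = B.charpoly := by
  have hdA : A.charpoly.natDegree = 2 := by rw [Matrix.charpoly_natDegree_eq_dim, Fintype.card_fin]
  have hdB : B.charpoly.natDegree = 2 := by rw [Matrix.charpoly_natDegree_eq_dim, Fintype.card_fin]
  refine Polynomial.ext fun k => ?_
  rcases k with _ | _ | _ | k
  · exact h0
  · exact h1
  · have hA2 : A.charpoly.coeff 2 = 1 := by simpa [hdA] using (Matrix.charpoly_monic A).coeff_natDegree
    have hB2 : B.charpoly.coeff 2 = 1 := by simpa [hdB] using (Matrix.charpoly_monic B).coeff_natDegree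
    rw [hA2, hB2]
  · rw [Polynomial.coeff_eq_zero_of_natDegree_lt (by omega), Polynomial.coeff_eq_zero_of_natDegree_lt (by omega)]

/-- **Among the stable classes of `H(F)` with semisimple `U(J₂)`-component, a class is determined by three scalars**: if `𝒪 = 𝒪′_st(a)`, `𝒪′ = 𝒪′_st(a′)` with
`a₂`, `a₂′` semisimple, and the classes have the same `U(J₂)`-characteristic-polynomial coefficients in degrees `0`, `1` (★ `StableClassH.fst`, ★
`StableClass.charpoly`) and the same `U(J₁)`-scalar (★ `StableClassH.sndVal`), then `𝒪 = 𝒪′`. [cite: Rogawski1990, §3.1 p. 19] [cite: Jacobson, Ch. IV §7 Thm. 5] -/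
theorem stableClassH_eq_of_coeff_charpoly_fst_eq_of_sndVal_eq_of_isSemisimpleElt {𝒪 𝒪' : StableClassH σ J₂ J₁}
    (h𝒪 : ∃ a : unitaryGroup σ J₂ × unitaryGroup σ J₁, stableClassHOf σ J₂ J₁ a = 𝒪 ∧ IsSemisimpleElt σ J₂ a.1)
    (h𝒪' : ∃ a' : unitaryGroup σ J₂ × unitaryGroup σ J₁, stableClassHOf σ J₂ J₁ a' = 𝒪' ∧ IsSemisimpleElt σ J₂ a'.1)
    (h0 : 𝒪.fst.charpoly.coeff 0 = 𝒪'.fst.charpoly.coeff 0) (h1 : 𝒪.fst.charpoly.coeff 1 = 𝒪'.fst.charpoly.coeff 1)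
    (hs : 𝒪.sndVal = 𝒪'.sndVal) : 𝒪 = 𝒪' := by
  obtain ⟨a, rfl, ha⟩ := h𝒪
  obtain ⟨a', rfl, ha'⟩ := h𝒪'
  simp only [StableClassH.fst_stableClassHOf, StableClass.charpoly_stableClassOf, StableClassH.sndVal_stableClassHOf] at h0 h1 hs
  exact stableClassHOf_eq_iff.mpr (isStablyConjH_of_charpoly_fst_eq_of_snd_eq_of_isSemisimpleElt ha ha'
    (charpoly_eq_of_coeff_zero_eq_of_coeff_one_eq' h0 h1).symm (Subtype.ext (GL_fin_one_eq_of_apply_eq' hs.symm)))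

end Algebra

/-! ## §2 Only finitely many stable classes of `H` with semisimple image are met by a compact set of adèles; the support of `Φ^st_H` -/

section Adelic

variable {L : Type} [Field L] [NumberField L] [IsCMField L]

/-- The coefficients of the characteristic polynomial of the `U(Φ₂)(𝔸)`-component depend continuously on `h ∈ H(𝐀)`. [folklore] -/
private theorem continuous_coeff_charpoly_fst' (k : ℕ) :
    Continuous fun h : (UnitaryGroup.cmDatum L 2 (Matrix.of fun i j : Fin 2 => if i.val + j.val + 1 = 2 then (1 : L) else 0)).Adelic ×
        (UnitaryGroup.cmDatum L 1 (Matrix.of fun i j : Fin 1 => if i.val + j.val + 1 = 1 then (1 : L) else 0)).Adelic =>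
      ((h.1.val : GL (Fin 2) (AdeleRing (𝓞 L) L)) : Matrix (Fin 2) (Fin 2) (AdeleRing (𝓞 L) L)).charpoly.coeff k :=
  (continuous_charpoly_coeff k).comp (Units.continuous_val.comp (continuous_subtype_val.comp continuous_fst))

/-- The `U(Φ₁)(𝔸)`-coordinate depends continuously on `h ∈ H(𝐀)`. [folklore] -/
private theorem continuous_snd_apply' :
    Continuous fun h : (UnitaryGroup.cmDatum L 2 (Matrix.of fun i j : Fin 2 => if i.val + j.val + 1 = 2 then (1 : L) else 0)).Adelic ×
        (UnitaryGroup.cmDatum L 1 (Matrix.of fun i j : Fin 1 => if i.val + j.val + 1 = 1 then (1 : L) else 0)).Adelic =>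
      ((h.2.val : GL (Fin 1) (AdeleRing (𝓞 L) L)) : Matrix (Fin 1) (Fin 1) (AdeleRing (𝓞 L) L)) 0 0 :=
  (Units.continuous_val.comp (continuous_subtype_val.comp continuous_snd)).matrix_elem 0 0

/-- **Only finitely many stable classes `𝒪′_st ⊂ H(L⁺)` WITH SEMISIMPLE `U(Φ₂)`-COMPONENT have an adelic stable class `𝒞′_𝐀(γ_H)` some member of which meets a
given compact `C ⊂ H(𝐀) = U(Φ₂)(𝔸) × U(Φ₁)(𝔸)`** — the singular ∕ central twin of ★ `finite_setOf_stableClassH_meets`: the three rational scalars of such a class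
are read off any `h ∈ C` in its adelic stable class (★ `MatchingAdeleH.coeff_charpoly_adele_fst_eq`, ★ `MatchingAdeleH.adele_snd_apply_eq`), lie in finite sets
(★ `finite_setOf_algebraMap_mem_of_isCompact`), and determine the class among the classes with semisimple image (§1).
[cite: Rogawski1990, §5.4 pp. 72–73; §14.5 Thm. 14.5.1 (a) p. 238] [cite: CasselsFrohlichANT1967, Ch. II §14] -/
theorem finite_setOf_stableClassH_meets_of_isSemisimpleElt
    {C : Set ((UnitaryGroup.cmDatum L 2 (Matrix.of fun i j : Fin 2 => if i.val + j.val + 1 = 2 then (1 : L) else 0)).Adelic ×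
      (UnitaryGroup.cmDatum L 1 (Matrix.of fun i j : Fin 1 => if i.val + j.val + 1 = 1 then (1 : L) else 0)).Adelic)} (hC : IsCompact C) :
    {𝒪H : StableClassH (cmConjRingHom L) (Matrix.of fun i j : Fin 2 => if i.val + j.val + 1 = 2 then (1 : L) else 0)
        (Matrix.of fun i j : Fin 1 => if i.val + j.val + 1 = 1 then (1 : L) else 0) |
      ∃ γH : (UnitaryGroup.cmDatum L 2 (Matrix.of fun i j : Fin 2 => if i.val + j.val + 1 = 2 then (1 : L) else 0)).Rational ×
          (UnitaryGroup.cmDatum L 1 (Matrix.of fun i j : Fin 1 => if i.val + j.val + 1 = 1 then (1 : L) else 0)).Rational,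
        stableClassHOf (cmConjRingHom L) _ _ γH = 𝒪H ∧ IsSemisimpleElt (cmConjRingHom L) (Matrix.of fun i j : Fin 2 => if i.val + j.val + 1 = 2 then (1 : L) else 0) γH.1 ∧
          ∃ c ∈ adelicStableClassesOverH L γH, ∃ h ∈ C, ConjClasses.mk h = c}.Finite := by
  classical
  -- the finite sets of rational scalars whose diagonal image lies in a coordinate image of `C`
  have hF : ∀ {φ : (UnitaryGroup.cmDatum L 2 (Matrix.of fun i j : Fin 2 => if i.val + j.val + 1 = 2 then (1 : L) else 0)).Adelic ×
      (UnitaryGroup.cmDatum L 1 (Matrix.of fun i j : Fin 1 => if i.val + j.val + 1 = 1 then (1 : L) else 0)).Adelic → AdeleRing (𝓞 L) L},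
      Continuous φ → {ξ : L | algebraMap L (AdeleRing (𝓞 L) L) ξ ∈ φ '' C}.Finite :=
    fun hφ => finite_setOf_algebraMap_mem_of_isCompact (hC.image hφ)
  have hF₀ := hF (continuous_coeff_charpoly_fst' (L := L) 0)
  have hF₁ := hF (continuous_coeff_charpoly_fst' (L := L) 1)
  have hF₂ := hF (continuous_snd_apply' (L := L))
  -- the three scalars of a stable class
  let Ψ : StableClassH (cmConjRingHom L) (Matrix.of fun i j : Fin 2 => if i.val + j.val + 1 = 2 then (1 : L) else 0)
        (Matrix.of fun i j : Fin 1 => if i.val + j.val + 1 = 1 then (1 : L) else 0) → L × L × L :=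
    fun 𝒪 => (𝒪.fst.charpoly.coeff 0, 𝒪.fst.charpoly.coeff 1, 𝒪.sndVal)
  refine Set.Finite.of_finite_image (f := Ψ) ((hF₀.prod (hF₁.prod hF₂)).subset ?_) ?_
  · -- the scalars of a class in the set lie in the finite sets
    rintro _ ⟨𝒪, ⟨γH, rfl, -, c, hc, h, hhC, hh⟩, rfl⟩
    obtain ⟨q, hq⟩ := exists_matchingAdeleH_adele_eq_of_mem hc hh
    subst hq
    simp only [Set.mem_prod, Set.mem_setOf_eq, Ψ, StableClassH.fst_stableClassHOf, StableClass.charpoly_stableClassOf,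
      StableClassH.sndVal_stableClassHOf]
    exact ⟨⟨q.adele, hhC, q.coeff_charpoly_adele_fst_eq 0⟩, ⟨q.adele, hhC, q.coeff_charpoly_adele_fst_eq 1⟩, ⟨q.adele, hhC, q.adele_snd_apply_eq⟩⟩
  · -- the scalars determine the class among the classes with semisimple image
    rintro 𝒪 ⟨γH, h𝒪, hss, -⟩ 𝒪' ⟨γH', h𝒪', hss', -⟩ hΨ
    simp only [Ψ, Prod.mk.injEq] at hΨ
    exact stableClassH_eq_of_coeff_charpoly_fst_eq_of_sndVal_eq_of_isSemisimpleElt ⟨γH, h𝒪, hss⟩ ⟨γH', h𝒪', hss'⟩ hΨ.1 hΨ.2.1 hΨ.2.2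

variable [∀ h : (UnitaryGroup.cmDatum L 2 (Matrix.of fun i j : Fin 2 => if i.val + j.val + 1 = 2 then (1 : L) else 0)).Adelic ×
      (UnitaryGroup.cmDatum L 1 (Matrix.of fun i j : Fin 1 => if i.val + j.val + 1 = 1 then (1 : L) else 0)).Adelic,
  MeasurableSpace (((UnitaryGroup.cmDatum L 2 (Matrix.of fun i j : Fin 2 => if i.val + j.val + 1 = 2 then (1 : L) else 0)).Adelic ×
      (UnitaryGroup.cmDatum L 1 (Matrix.of fun i j : Fin 1 => if i.val + j.val + 1 = 1 then (1 : L) else 0)).Adelic) ⧸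
    Subgroup.centralizer ({h} : Set ((UnitaryGroup.cmDatum L 2 (Matrix.of fun i j : Fin 2 => if i.val + j.val + 1 = 2 then (1 : L) else 0)).Adelic ×
      (UnitaryGroup.cmDatum L 1 (Matrix.of fun i j : Fin 1 => if i.val + j.val + 1 = 1 then (1 : L) else 0)).Adelic)))]

/-- **The support of `𝒪′_st ↦ Φ^st_H(γ_H(𝒪′_st), m, f^H)` on the stable classes of `H(L⁺)` with semisimple image is FINITE** — for EVERY class-indexed family
`m` of orbital measures on `H(𝐀)` and every `f^H` with compact support (the singular ∕ central twin of ★ `finite_setOf_stableClassH_adelicStableOrbitalIntegralH_ne_zero`: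
a non-zero `Φ^st_H = Σᶠ_{𝒞′_𝐀(γ_H)} Φ(δ, f^H)` has a non-zero class term, that class meets `tsupport f^H` (★ `exists_mem_tsupport_mk_eq_of_classOrbitalIntegral_ne_zero`),
and the theorem above applies with `C := tsupport f^H`). [cite: Rogawski1990, §5.4 pp. 72–73; §14.5 Thm. 14.5.1 (a) p. 238] -/
theorem finite_setOf_stableClassH_adelicStableOrbitalIntegralH_ne_zero_of_isSemisimpleElt
    (m : OrbitalMeasureFamily ((UnitaryGroup.cmDatum L 2 (Matrix.of fun i j : Fin 2 => if i.val + j.val + 1 = 2 then (1 : L) else 0)).Adelic ×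
      (UnitaryGroup.cmDatum L 1 (Matrix.of fun i j : Fin 1 => if i.val + j.val + 1 = 1 then (1 : L) else 0)).Adelic))
    {fH : (UnitaryGroup.cmDatum L 2 (Matrix.of fun i j : Fin 2 => if i.val + j.val + 1 = 2 then (1 : L) else 0)).Adelic ×
      (UnitaryGroup.cmDatum L 1 (Matrix.of fun i j : Fin 1 => if i.val + j.val + 1 = 1 then (1 : L) else 0)).Adelic → ℂ}
    (hf : HasCompactSupport fH) :
    {𝒪H : StableClassH (cmConjRingHom L) (Matrix.of fun i j : Fin 2 => if i.val + j.val + 1 = 2 then (1 : L) else 0)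
        (Matrix.of fun i j : Fin 1 => if i.val + j.val + 1 = 1 then (1 : L) else 0) |
      ∃ γH : (UnitaryGroup.cmDatum L 2 (Matrix.of fun i j : Fin 2 => if i.val + j.val + 1 = 2 then (1 : L) else 0)).Rational ×
          (UnitaryGroup.cmDatum L 1 (Matrix.of fun i j : Fin 1 => if i.val + j.val + 1 = 1 then (1 : L) else 0)).Rational,
        stableClassHOf (cmConjRingHom L) _ _ γH = 𝒪H ∧ IsSemisimpleElt (cmConjRingHom L) (Matrix.of fun i j : Fin 2 => if i.val + j.val + 1 = 2 then (1 : L) else 0) γH.1 ∧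
          adelicStableOrbitalIntegralH L γH m fH ≠ 0}.Finite := by
  refine (finite_setOf_stableClassH_meets_of_isSemisimpleElt (L := L) hf.isCompact).subset ?_
  rintro 𝒪H ⟨γH, h𝒪, hss, hne⟩
  refine ⟨γH, h𝒪, hss, ?_⟩
  -- a non-zero `finsum` over `𝒞′_𝐀(γ_H)` has a non-zero term
  obtain ⟨c, hc, hcne⟩ : ∃ c ∈ adelicStableClassesOverH L γH, classOrbitalIntegral m fH c ≠ 0 := by
    by_contra hall
    push Not at hall
    exact hne (by rw [adelicStableOrbitalIntegralH_def]; exact finsum_mem_of_eqOn_zero hall)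
  obtain ⟨h, hh, hhc⟩ := exists_mem_tsupport_mk_eq_of_classOrbitalIntegral_ne_zero m hcne
  exact ⟨c, hc, h, hh, hhc⟩

/-- The same for `f^H ∈ C_c(H(𝐀), ℂ)`. [cite: Rogawski1990, §5.4 pp. 72–73; §14.5 Thm. 14.5.1 (a) p. 238] -/
theorem finite_setOf_stableClassH_adelicStableOrbitalIntegralH_ne_zero_cc_of_isSemisimpleElt
    (m : OrbitalMeasureFamily ((UnitaryGroup.cmDatum L 2 (Matrix.of fun i j : Fin 2 => if i.val + j.val + 1 = 2 then (1 : L) else 0)).Adelic ×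
      (UnitaryGroup.cmDatum L 1 (Matrix.of fun i j : Fin 1 => if i.val + j.val + 1 = 1 then (1 : L) else 0)).Adelic))
    (fH : CompactlySupportedContinuousMap ((UnitaryGroup.cmDatum L 2 (Matrix.of fun i j : Fin 2 => if i.val + j.val + 1 = 2 then (1 : L) else 0)).Adelic ×
      (UnitaryGroup.cmDatum L 1 (Matrix.of fun i j : Fin 1 => if i.val + j.val + 1 = 1 then (1 : L) else 0)).Adelic) ℂ) :
    {𝒪H : StableClassH (cmConjRingHom L) (Matrix.of fun i j : Fin 2 => if i.val + j.val + 1 = 2 then (1 : L) else 0)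
        (Matrix.of fun i j : Fin 1 => if i.val + j.val + 1 = 1 then (1 : L) else 0) |
      ∃ γH : (UnitaryGroup.cmDatum L 2 (Matrix.of fun i j : Fin 2 => if i.val + j.val + 1 = 2 then (1 : L) else 0)).Rational ×
          (UnitaryGroup.cmDatum L 1 (Matrix.of fun i j : Fin 1 => if i.val + j.val + 1 = 1 then (1 : L) else 0)).Rational,
        stableClassHOf (cmConjRingHom L) _ _ γH = 𝒪H ∧ IsSemisimpleElt (cmConjRingHom L) (Matrix.of fun i j : Fin 2 => if i.val + j.val + 1 = 2 then (1 : L) else 0) γH.1 ∧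
          adelicStableOrbitalIntegralH L γH m fH ≠ 0}.Finite :=
  finite_setOf_stableClassH_adelicStableOrbitalIntegralH_ne_zero_of_isSemisimpleElt m fH.hasCompactSupport

/-- **The `G`-regular support is contained in the semisimple-image support** (★ `IsGRegular.isSemisimpleElt_fst`): the finite set of ★
`finite_setOf_stableClassH_adelicStableOrbitalIntegralH_ne_zero` lies in the finite set above. [cite: Rogawski1990, §14.5 Thm. 14.5.1 (a) p. 238] -/
theorem setOf_isGRegular_adelicStableOrbitalIntegralH_ne_zero_subset
    (m : OrbitalMeasureFamily ((UnitaryGroup.cmDatum L 2 (Matrix.of fun i j : Fin 2 => if i.val + j.val + 1 = 2 then (1 : L) else 0)).Adelic ×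
      (UnitaryGroup.cmDatum L 1 (Matrix.of fun i j : Fin 1 => if i.val + j.val + 1 = 1 then (1 : L) else 0)).Adelic))
    (fH : (UnitaryGroup.cmDatum L 2 (Matrix.of fun i j : Fin 2 => if i.val + j.val + 1 = 2 then (1 : L) else 0)).Adelic ×
      (UnitaryGroup.cmDatum L 1 (Matrix.of fun i j : Fin 1 => if i.val + j.val + 1 = 1 then (1 : L) else 0)).Adelic → ℂ) :
    {𝒪H : StableClassH (cmConjRingHom L) (Matrix.of fun i j : Fin 2 => if i.val + j.val + 1 = 2 then (1 : L) else 0)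
        (Matrix.of fun i j : Fin 1 => if i.val + j.val + 1 = 1 then (1 : L) else 0) |
      ∃ γH : (UnitaryGroup.cmDatum L 2 (Matrix.of fun i j : Fin 2 => if i.val + j.val + 1 = 2 then (1 : L) else 0)).Rational ×
          (UnitaryGroup.cmDatum L 1 (Matrix.of fun i j : Fin 1 => if i.val + j.val + 1 = 1 then (1 : L) else 0)).Rational,
        stableClassHOf (cmConjRingHom L) _ _ γH = 𝒪H ∧
          IsGRegular (cmConjRingHom L) (Matrix.of fun i j : Fin 2 => if i.val + j.val + 1 = 2 then (1 : L) else 0)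
            (Matrix.of fun i j : Fin 1 => if i.val + j.val + 1 = 1 then (1 : L) else 0)
            (Matrix.of fun i j : Fin 3 => if i.val + j.val + 1 = 3 then (1 : L) else 0) endoForm_antidiagOne γH ∧
          adelicStableOrbitalIntegralH L γH m fH ≠ 0} ⊆
    {𝒪H : StableClassH (cmConjRingHom L) (Matrix.of fun i j : Fin 2 => if i.val + j.val + 1 = 2 then (1 : L) else 0)
        (Matrix.of fun i j : Fin 1 => if i.val + j.val + 1 = 1 then (1 : L) else 0) |
      ∃ γH : (UnitaryGroup.cmDatum L 2 (Matrix.of fun i j : Fin 2 => if i.val + j.val + 1 = 2 then (1 : L) else 0)).Rational ×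
          (UnitaryGroup.cmDatum L 1 (Matrix.of fun i j : Fin 1 => if i.val + j.val + 1 = 1 then (1 : L) else 0)).Rational,
        stableClassHOf (cmConjRingHom L) _ _ γH = 𝒪H ∧ IsSemisimpleElt (cmConjRingHom L) (Matrix.of fun i j : Fin 2 => if i.val + j.val + 1 = 2 then (1 : L) else 0) γH.1 ∧
          adelicStableOrbitalIntegralH L γH m fH ≠ 0} := by
  rintro 𝒪H ⟨γH, h𝒪, hreg, hne⟩
  exact ⟨γH, h𝒪, hreg.isSemisimpleElt_fst, hne⟩

end Adelic

end Literature.NumberTheory.Rogawski1990
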